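import Summits.BirchSwinnertonDyer.BirchSwinnertonDyer.Theorems.GoldfeldAllTwistsTwoConverseTwinGenusVoidNegPrime
import HarnessLib

set_option linter.dupNamespace false -- `…BirchSwinnertonDyer.BirchSwinnertonDyer…` is the cell's namespace (D-0017)
set_option autoImplicit false

/-!
# LINE B49, family F3 — the VOID lemma for ANY non-trivial `σ : K →ₐ[ℚ] K` (the currency of the tree's Heegner-point
# conjugation facts), and «`σ ≠ id` ⟹ `σ` = the quadratic conjugation»

Cell `bsd-goldfeld`, seat `bsd-goldfeld-s1p-c3` (prover, gen 12); companion to `…TwinGenusVoidNegPrime` (p527718; planner g28 (cxxxi)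
TIER 0). Support for item `stmt-BirchSwinnertonDyer-19350` (serves 19140/20044 via LINE B49's family F3 and the `s1p-c3x` lane's Theorem A″,
LANE-BRIEF-S1P-C3X §2 file (3): «c3's Tier-0 VOID lemma (V) by IMPORT only»). Theses-free; theorems only. HONEST FRAMING: nothing about BSD;
Birch's relation stays a HYPOTHESIS `hY`; CLTZ15 Thm. 1.4 enters by name (`h14`).

WHY: `…TwinGenusVoidNegPrime` states the conjugation of `K = ℚ(√d_K)` as the tree's explicit `Quadratic.conj hK.1 hθ hδ` (the currency
of `QuadraticDescent.twistMap` / `exists_twistMap_eq_of_conjMap_eq_neg`), whereas the Heegner-point facts (`heegnerPoint_conj_add_rootNumber_smul`,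
ty's (δ)/(δ′) files) speak of an arbitrary `σ : K →ₐ[ℚ] K` with `σ ≠ AlgHom.id ℚ K`. §1 proves the folklore bridge
`algHom_eq_quadraticConj_of_ne_id` (in a quadratic extension `F(θ)`, `θ² = c`, `2 ≠ 0`, a non-identity `F`-endomorphism IS the conjugation:
`σθ = ±θ`, and `+θ` forces `σ = id` on `F ⊕ Fθ`); §2 restates the VOID lemma on `X₀(49)(K)` for any such `σ`
(`exists_sub_two_zsmul_isOfFinAddOrder_of_birch_negPrime_cm7'`), with no `δ`/`hθ`/`hδ` in the interface.
References: J. Coates, Y. Li, Y. Tian, S. Zhai, PLMS 110 (2015) Thm 1.4, Thm 2.2 [CoatesLiTianZhai2015]; J. H. Silverman, AEC (2009)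
X.2 Prop. 2.4, Exercise 10.16 [SilvermanAEC2009].
-/

noncomputable section

open scoped Classical

open WeierstrassCurve Literature.NumberTheory.EllipticCurves Literature.NumberTheory.EllipticCurves.ModularForms
  Literature.NumberTheory.EllipticCurves.CoatesLiTianZhai2015 WeierstrassCurve.QuadraticDescent

namespace Summit.BirchSwinnertonDyer.BirchSwinnertonDyer.Theorems.GoldfeldGoodTwists

/-! ## §1 A non-identity endomorphism of a quadratic extension is the conjugation -/

/-- In a quadratic extension `K = F(θ)`, `θ² = c ∈ F`, `θ ∉ F`, `2 ≠ 0` in `F`: an `F`-algebra endomorphism `σ ≠ id` IS the conjugation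
`Quadratic.conj` (`σθ` is a root of `X² − c`, so `σθ = ±θ`; `σθ = θ` would make `σ = id` on `K = F ⊕ Fθ`). [folklore] -/
theorem algHom_eq_quadraticConj_of_ne_id {F K : Type*} [Field F] [Field K] [Algebra F K] [NeZero (2 : F)]
    (h2 : Module.finrank F K = 2) {θ : K} {c : F} (hθ : θ ∉ Set.range (algebraMap F K)) (hc : θ ^ 2 = algebraMap F K c)
    (σ : K →ₐ[F] K) (hσ : σ ≠ AlgHom.id F K) : σ = Literature.NumberTheory.QuadraticFields.Quadratic.conj h2 hθ hc := by
  have hsq : (σ θ - θ) * (σ θ + θ) = 0 := by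
    have h := congrArg σ hc
    rw [map_pow, AlgHom.commutes] at h
    linear_combination h - hc
  have hneg : σ θ = -θ := by
    rcases mul_eq_zero.mp hsq with h | h
    · exfalso; apply hσ
      apply AlgHom.ext; intro x
      obtain ⟨a, b, rfl⟩ := Literature.NumberTheory.QuadraticFields.Quadratic.exists_eq_add_mul h2 hθ x
      rw [map_add, map_mul, AlgHom.commutes, AlgHom.commutes, sub_eq_zero.mp h, AlgHom.id_apply]
    · exact eq_neg_of_add_eq_zero_left h
  apply AlgHom.ext; intro x
  obtain ⟨a, b, rfl⟩ := Literature.NumberTheory.QuadraticFields.Quadratic.exists_eq_add_mul h2 hθ x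
  rw [map_add, map_mul, AlgHom.commutes, AlgHom.commutes, hneg,
    Literature.NumberTheory.QuadraticFields.Quadratic.conj_add_mul]
  ring

/-! ## §2 The VOID lemma on `X₀(49)(K)` for any non-trivial `σ` -/

section AnySigma

variable {K : Type} [Field K] [NumberField K]

/-- **THE VOID LEMMA on `X₀(49)(K)`, for any non-trivial `σ : K →ₐ[ℚ] K`.** Let `ℓ > 3` be a prime, `ℓ ≡ 3 (mod 4)`, `(ℓ/7) = −1`,
`K` imaginary quadratic with `d_K = −ℓ`, `σ ≠ id` a `ℚ`-endomorphism of `K` acting on `X₀(49)(K) = cm7(K)`, and `T = ι(2, −1)` the rational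
`2`-torsion point. GRANTED Coates–Li–Tian–Zhai 2015 Thm. 1.4 by name (`h14`: `rank 49a1^{(−ℓ)}(ℚ) = 1`) and Birch's relation
`Y + σY = T` for SOME `Y ∈ X₀(49)(K)` (hypothesis `hY`; the Heegner point, `h(−ℓ)` odd): every `P ∈ X₀(49)(K)` with `σP = −P` satisfies
`P − 2Q ∈ X₀(49)(K)_tors` for some `Q` — the anti-invariant part (≅ `49a1^{(−ℓ)}(ℚ)`) is `2`-divisible modulo torsion.
(`σ` is `Quadratic.conj` of `K = ℚ(√d_K)` by §1; then `exists_sub_two_zsmul_isOfFinAddOrder_of_birch_negPrime_cm7`.)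
[cite: CoatesLiTianZhai2015, Thm. 1.4 and Thm. 2.2] [cite: SilvermanAEC2009, X.2 Prop. 2.4 and Exercise 10.16] -/
theorem exists_sub_two_zsmul_isOfFinAddOrder_of_birch_negPrime_cm7' (h14 : thm14_rankOne_twist)
    (hK : IsImaginaryQuadratic K) {l : ℕ} (hl : l.Prime) (h3 : 3 < l) (hl4 : l % 4 = 3) (hl7 : jacobiSym l 7 = -1)
    (hdK : NumberField.discr K = -(l : ℤ)) (σ : K →ₐ[ℚ] K) (hσ : σ ≠ AlgHom.id ℚ K) {Y : (cm7.baseChange K).toAffine.Point}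
    (hY : Y + Affine.Point.map σ Y = incl K cm7 (.some 2 (-1) nonsingular_cm7_two_neg_one))
    (P : (cm7.baseChange K).toAffine.Point) (hP : Affine.Point.map σ P = -P) :
    ∃ Q : (cm7.baseChange K).toAffine.Point, IsOfFinAddOrder (P - (2 : ℤ) • Q) := by
  obtain ⟨δ, hδ, hδK, -⟩ := exists_sq_eq_discr_and_span hK
  have hθ : δ ∉ Set.range (algebraMap ℚ K) := by rintro ⟨a, ha⟩; exact hδK a ha
  have hσc := algHom_eq_quadraticConj_of_ne_id hK.1 hθ hδ σ hσ
  subst hσc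
  exact exists_sub_two_zsmul_isOfFinAddOrder_of_birch_negPrime_cm7 h14 hK hl h3 hl4 hl7 hdK hθ hδ hY P hP

end AnySigma

end Summit.BirchSwinnertonDyer.BirchSwinnertonDyer.Theorems.GoldfeldGoodTwists

end
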